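import Literature.MathematicalPhysics.QuantumFieldTheory.Balaban1983to89.B9CubeCoarsening

/-!
# `Balaban1983to89.B9CubeCoarseningGlobal` — THE GLOBAL TRANSFER OF BLOCK MAJORANTS FROM THE CUBE SEQUENCE `{Ω_n(□)}` TO THE MEMBER'S
# GEOMETRY (sources in ANY member block): a member block is a union of cube blocks, the pieces are summed with [4] Lemma 2.1 (2.61) for the
# cube sequence, at the cost `δ ↦ δ′ < δ` and a factor `c₁` — the companion of file 1b's `majorant_transfer_of_nearH`
# (sub-row G-B9-LETTERS, module M5.1a, file 1c)

FRAMING (verbatim cell line):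
statement-level skeleton of published theorems with citation tags; proofs where landed; nothing here is a claim about the Yang–Mills mass gap

Sources under audit (cell lit-balaban): T. Bałaban, *Propagators for lattice gauge theories in a background field*, Commun. Math. Phys. **99**
(1985) 389–434 [`Balaban1985BackgroundPropagators`, "B9"], Sect. C pp. 408–409; T. Bałaban, *Propagators and renormalization transformations
for lattice gauge theories. II*, Commun. Math. Phys. **96** (1984) 223–250 [`Balaban1984PropagatorsII`, "[4]"], (2.46) p. 231, (2.51) p. 232,
Lemma 2.1 (2.61) p. 234.  Unit `lit-balaban-r05` (r05 gen 77).

## WHAT IS PRINTED (verbatim up to notation)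

[4] (2.51) p. 232: «|(Tλ)(x)| ≤ K(y, y′)|λ|, x ∈ B^j(y), supp λ ⊂ B^{j′}(y′)»; Lemma 2.1 (2.61) p. 234: «sup_{y∈𝔅} Σ_{y′∈𝔅} e^{−αδ₀d(y,y′)} ≤ c₁(α)»;
[B9] p. 409 l. 1–5: the cube letters «satisfy all the inequalities of Theorems 3.1–3.3» — read by the cell in the member's blocks.

## WHAT THIS FILE CERTIFIES (kernel-checked; setting of `B9CubeSequence408` ∕ `B9CubeCoarsening`; `F := cubeFam D q …`)

* `blockPiece_cube_eq_zero_of_coarsen_ne` — a function supported in the member block `y′` has zero piece on every cube block not inside `y′`;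
* ★ **`majorant_transfer_global`**: if `T` has the (2.51)-majorant `C·L^{n·j(y)}·e^{−δ d_F(y,y′)}` over `F`, `0 ≤ δ′` (of interest: `δ′ < δ`), and the row sums
  `Σ_{c} e^{−(δ−δ′) d_F(b, c)} ≤ K` hold for every cube block `b` ((2.61) for `F` at the rate `δ − δ′`), then for EVERY member block `y′`, every
  `λ` with `supp λ ⊂ y′`, `|λ| ≤ B`, and every torus point `x`: `|(Tλ)(x)| ≤ C·K·L^{n·lev_D x}·e^{−δ′·d_D(y_D(x), y′)}·B`.
  Mechanism: `λ = Σ_c Δ(c)λ` over the cube blocks (`B6RandomWalk.sum_blockPiece`); pieces off `y′` vanish; for a piece inside `y′` the cube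
  bound is split `e^{−δ d_F} = e^{−δ′ d_F}·e^{−(δ−δ′) d_F}`, the first factor dominated through file 1b (`geomT_dist_coarsen_le`: `d_D ≤ d_F`,
  `coarsen c = y′`), the second summed by the hypothesis; levels only grow (`lev_F ≤ lev_D`).

## HONEST SCOPE

* Pure bookkeeping over the two block structures; the (2.61) row-sum bound enters AS A HYPOTHESIS (it is `B6Geom246MultiLevelTorusL0.lemma21_torus` ∕
  `B8Ineq198MultiLevelTorusL0.rowSum_and_thresholdT` for `F` under the (2.59) threshold `R·L·M_h ≥ N₁ + 1`; the instantiation is the consumer's).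
* Nothing is inferred from the manuscript; kernel-checked.  NOT summit progress; the YM mass gap is not proved by any of this.
-/

namespace Literature.MathematicalPhysics.QuantumFieldTheory.Balaban1983to89.B9CubeCoarseningGlobal

open Literature.MathematicalPhysics.QuantumFieldTheory.Balaban1983to89.B4Reflection242 (boxDom)
open Literature.MathematicalPhysics.QuantumFieldTheory.Balaban1983to89.B6MultiLevelBoxOperator (N0)
open Literature.MathematicalPhysics.QuantumFieldTheory.Balaban1983to89.B6Cover236MultiLevelBlocks (cubes)
open Literature.MathematicalPhysics.QuantumFieldTheory.Balaban1983to89.B6Geom246MultiLevelBox (bset blkOf)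
open Literature.MathematicalPhysics.QuantumFieldTheory.Balaban1983to89.B6Geom246MultiLevelTorus (geomT)
open Literature.MathematicalPhysics.QuantumFieldTheory.Balaban1983to89.B6Geom246MultiLevelTorusL0 (triangle_refl_nonneg_T)
open Literature.MathematicalPhysics.QuantumFieldTheory.Balaban1983to89.B6RandomWalk (HasMajorant BlockSupp blockPiece sum_blockPiece
  blockSupp_blockPiece)
open Literature.MathematicalPhysics.QuantumFieldTheory.Balaban1983to89.B9CubeSequence408 (cubeFam lev_cubeFam_le)
open Literature.MathematicalPhysics.QuantumFieldTheory.Balaban1983to89.B9CubeCoarsening (coarsen coarsen_blkOf geomT_dist_coarsen_le)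

variable {d ℓ Mh k R : ℕ} {P : Fin (d + 1) → ℕ} {D : B6MultiLevelTorusOperator.TDomains d ℓ Mh k P R} {q : ↥(cubes D.toDomains)}
  {hL : Odd (ℓ + 1)} {hM : Odd Mh} {hMh : 1 ≤ Mh} {hP : ∀ μ, 1 ≤ P μ}

/-- a function supported in the member block `y′` has ZERO piece on a cube block whose member block is not `y′`.
[cite: Balaban1984PropagatorsII, (2.45) p.231, (2.51) p.232, bookkeeping] -/
theorem blockPiece_cube_eq_zero_of_coarsen_ne {μ : ↥(boxDom (N0 ℓ Mh k P)) → ℝ} {y' : ↥(bset D.toDomains)} {B : ℝ}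
    (hμ : BlockSupp (g := geomT D) (blkOf D.toDomains) μ y' B)
    {c : ↥(B6Geom246MultiLevelBoxL0.bset (cubeFam D q hL hM hMh hP).toDomains)} (hc : coarsen c ≠ y') :
    blockPiece (g := B6Geom246MultiLevelTorusL0.geomT (cubeFam D q hL hM hMh hP))
      (B6Geom246MultiLevelBoxL0.blkOf (cubeFam D q hL hM hMh hP).toDomains) c μ = 0 := by
  funext z
  simp only [blockPiece, Pi.zero_apply]
  split_ifs with hz
  · refine hμ.off z fun hz' => hc ?_
    have e : coarsen (B6Geom246MultiLevelBoxL0.blkOf (cubeFam D q hL hM hMh hP).toDomains z) = blkOf D.toDomains z :=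
      coarsen_blkOf z
    rw [← hz, e, hz']
  · rfl

/-- ★ **GLOBAL TRANSFER OF BLOCK MAJORANTS FROM THE CUBE SEQUENCE TO THE MEMBER** (any source block; rate `δ ↦ δ′`, factor = the (2.61) row
sum of the cube sequence at the rate `δ − δ′`). [cite: Balaban1984PropagatorsII, (2.51) p.232, (2.46) p.231, Lemma 2.1 (2.61) p.234; Balaban1985BackgroundPropagators, p.409 l.1–5] -/
theorem majorant_transfer_global {T : Module.End ℝ (↥(boxDom (N0 ℓ Mh k P)) → ℝ)} {C δ δ' K : ℝ} {n : ℕ}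
    (hC : 0 ≤ C) (hδ' : 0 ≤ δ')
    (hT : HasMajorant (g := B6Geom246MultiLevelTorusL0.geomT (cubeFam D q hL hM hMh hP))
      (B6Geom246MultiLevelBoxL0.blkOf (cubeFam D q hL hM hMh hP).toDomains) T
      (fun y y' => C * ((ℓ : ℝ) + 1) ^ (n * y.1.1) *
        Real.exp (-(δ * (B6Geom246MultiLevelTorusL0.geomT (cubeFam D q hL hM hMh hP)).dist y y'))))
    (hK : ∀ b : ↥(B6Geom246MultiLevelBoxL0.bset (cubeFam D q hL hM hMh hP).toDomains),
      ∑ c : ↥(B6Geom246MultiLevelBoxL0.bset (cubeFam D q hL hM hMh hP).toDomains),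
        Real.exp (-((δ - δ') * (B6Geom246MultiLevelTorusL0.geomT (cubeFam D q hL hM hMh hP)).dist b c)) ≤ K)
    (y' : ↥(bset D.toDomains)) (μ : ↥(boxDom (N0 ℓ Mh k P)) → ℝ) (B : ℝ)
    (hμ : BlockSupp (g := geomT D) (blkOf D.toDomains) μ y' B) (x : ↥(boxDom (N0 ℓ Mh k P))) :
    |T μ x| ≤ C * K * ((ℓ : ℝ) + 1) ^ (n * D.lev x.1) * Real.exp (-(δ' * (geomT D).dist (blkOf D.toDomains x) y')) * B := by
  classical
  -- notation-free abbreviations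
  have hL1 : (1 : ℝ) ≤ (ℓ : ℝ) + 1 := by linarith [(Nat.cast_nonneg ℓ : (0 : ℝ) ≤ ℓ)]
  have hB := hμ.nonneg
  have hdistF := (triangle_refl_nonneg_T (cubeFam D q hL hM hMh hP) hMh hP).2.2
  -- the common factor at `x`
  have hE0 : 0 ≤ C * ((ℓ : ℝ) + 1) ^ (n * D.lev x.1) * Real.exp (-(δ' * (geomT D).dist (blkOf D.toDomains x) y')) * B :=
    mul_nonneg (mul_nonneg (mul_nonneg hC (pow_nonneg (by linarith) _)) (Real.exp_nonneg _)) hB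
  -- the decomposition of `μ` into its cube pieces and the termwise bound
  have hsum : μ = ∑ c, blockPiece (g := B6Geom246MultiLevelTorusL0.geomT (cubeFam D q hL hM hMh hP))
      (B6Geom246MultiLevelBoxL0.blkOf (cubeFam D q hL hM hMh hP).toDomains) c μ := (sum_blockPiece _ μ).symm
  have hterm : ∀ c : ↥(B6Geom246MultiLevelBoxL0.bset (cubeFam D q hL hM hMh hP).toDomains),
      |T (blockPiece (g := B6Geom246MultiLevelTorusL0.geomT (cubeFam D q hL hM hMh hP))
          (B6Geom246MultiLevelBoxL0.blkOf (cubeFam D q hL hM hMh hP).toDomains) c μ) x| ≤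
        C * ((ℓ : ℝ) + 1) ^ (n * D.lev x.1) * Real.exp (-(δ' * (geomT D).dist (blkOf D.toDomains x) y')) * B *
          Real.exp (-((δ - δ') * (B6Geom246MultiLevelTorusL0.geomT (cubeFam D q hL hM hMh hP)).dist
            (B6Geom246MultiLevelBoxL0.blkOf (cubeFam D q hL hM hMh hP).toDomains x) c)) := by
    intro c
    by_cases hc : coarsen c = y'
    · -- a piece inside `y′`: the cube bound, then coarsening
      have hbound : ∀ z : ↥(boxDom (N0 ℓ Mh k P)),
          B6Geom246MultiLevelBoxL0.blkOf (cubeFam D q hL hM hMh hP).toDomains z = c → |μ z| ≤ B := by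
        intro z hz
        refine hμ.bound z ?_
        have e : coarsen (B6Geom246MultiLevelBoxL0.blkOf (cubeFam D q hL hM hMh hP).toDomains z) = blkOf D.toDomains z :=
          coarsen_blkOf z
        rw [← e, hz, hc]
      have hpc : BlockSupp (g := B6Geom246MultiLevelTorusL0.geomT (cubeFam D q hL hM hMh hP))
          (B6Geom246MultiLevelBoxL0.blkOf (cubeFam D q hL hM hMh hP).toDomains)
          (blockPiece (g := B6Geom246MultiLevelTorusL0.geomT (cubeFam D q hL hM hMh hP))
            (B6Geom246MultiLevelBoxL0.blkOf (cubeFam D q hL hM hMh hP).toDomains) c μ) c B :=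
        blockSupp_blockPiece (g := B6Geom246MultiLevelTorusL0.geomT (cubeFam D q hL hM hMh hP)) _ μ c B hB hbound
      have h := hT c _ B hpc x
      refine h.trans ?_
      beta_reduce
      have hd : (geomT D).dist (blkOf D.toDomains x) y' ≤
          (B6Geom246MultiLevelTorusL0.geomT (cubeFam D q hL hM hMh hP)).dist
            (B6Geom246MultiLevelBoxL0.blkOf (cubeFam D q hL hM hMh hP).toDomains x) c := by
        have e : coarsen (B6Geom246MultiLevelBoxL0.blkOf (cubeFam D q hL hM hMh hP).toDomains x) = blkOf D.toDomains x :=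
          coarsen_blkOf x
        rw [← e, ← hc]
        exact geomT_dist_coarsen_le hMh hP _ _
      have hdd := hdistF (B6Geom246MultiLevelBoxL0.blkOf (cubeFam D q hL hM hMh hP).toDomains x) c
      have hlev : (B6Geom246MultiLevelBoxL0.blkOf (cubeFam D q hL hM hMh hP).toDomains x).1.1 ≤ D.lev x.1 :=
        lev_cubeFam_le (hL := hL) (hM := hM) (hMh := hMh) (hP := hP) x.1
      have hpow : ((ℓ : ℝ) + 1) ^ (n * (B6Geom246MultiLevelBoxL0.blkOf (cubeFam D q hL hM hMh hP).toDomains x).1.1) ≤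
          ((ℓ : ℝ) + 1) ^ (n * D.lev x.1) := pow_le_pow_right₀ hL1 (Nat.mul_le_mul_left n hlev)
      -- split the exponential
      have hexp : Real.exp (-(δ * (B6Geom246MultiLevelTorusL0.geomT (cubeFam D q hL hM hMh hP)).dist
            (B6Geom246MultiLevelBoxL0.blkOf (cubeFam D q hL hM hMh hP).toDomains x) c)) ≤
          Real.exp (-(δ' * (geomT D).dist (blkOf D.toDomains x) y')) *
            Real.exp (-((δ - δ') * (B6Geom246MultiLevelTorusL0.geomT (cubeFam D q hL hM hMh hP)).dist
              (B6Geom246MultiLevelBoxL0.blkOf (cubeFam D q hL hM hMh hP).toDomains x) c)) := by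
        rw [← Real.exp_add]
        refine Real.exp_le_exp.2 ?_
        nlinarith
      calc C * ((ℓ : ℝ) + 1) ^ (n * (B6Geom246MultiLevelBoxL0.blkOf (cubeFam D q hL hM hMh hP).toDomains x).1.1) *
            Real.exp (-(δ * (B6Geom246MultiLevelTorusL0.geomT (cubeFam D q hL hM hMh hP)).dist
              (B6Geom246MultiLevelBoxL0.blkOf (cubeFam D q hL hM hMh hP).toDomains x) c)) * B
          ≤ C * ((ℓ : ℝ) + 1) ^ (n * D.lev x.1) *
            (Real.exp (-(δ' * (geomT D).dist (blkOf D.toDomains x) y')) *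
              Real.exp (-((δ - δ') * (B6Geom246MultiLevelTorusL0.geomT (cubeFam D q hL hM hMh hP)).dist
                (B6Geom246MultiLevelBoxL0.blkOf (cubeFam D q hL hM hMh hP).toDomains x) c))) * B := by
            refine mul_le_mul_of_nonneg_right (mul_le_mul (mul_le_mul_of_nonneg_left hpow hC) hexp (Real.exp_nonneg _)
              (mul_nonneg hC (pow_nonneg (by linarith) _))) hB
        _ = _ := by ring
    · -- a piece off `y′` vanishes
      rw [blockPiece_cube_eq_zero_of_coarsen_ne hμ hc, map_zero, Pi.zero_apply, abs_zero]
      exact mul_nonneg hE0 (Real.exp_nonneg _)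
  -- sum the termwise bounds
  have hTsum : T μ x = ∑ c, T (blockPiece (g := B6Geom246MultiLevelTorusL0.geomT (cubeFam D q hL hM hMh hP))
      (B6Geom246MultiLevelBoxL0.blkOf (cubeFam D q hL hM hMh hP).toDomains) c μ) x := by
    conv_lhs => rw [hsum]
    rw [map_sum, Finset.sum_apply]
  rw [hTsum]
  refine (Finset.abs_sum_le_sum_abs _ _).trans ?_
  refine (Finset.sum_le_sum fun c _ => hterm c).trans ?_
  rw [← Finset.mul_sum]
  have hKx := hK (B6Geom246MultiLevelBoxL0.blkOf (cubeFam D q hL hM hMh hP).toDomains x)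
  calc C * ((ℓ : ℝ) + 1) ^ (n * D.lev x.1) * Real.exp (-(δ' * (geomT D).dist (blkOf D.toDomains x) y')) * B *
        ∑ c, Real.exp (-((δ - δ') * (B6Geom246MultiLevelTorusL0.geomT (cubeFam D q hL hM hMh hP)).dist
          (B6Geom246MultiLevelBoxL0.blkOf (cubeFam D q hL hM hMh hP).toDomains x) c))
      ≤ C * ((ℓ : ℝ) + 1) ^ (n * D.lev x.1) * Real.exp (-(δ' * (geomT D).dist (blkOf D.toDomains x) y')) * B * K :=
        mul_le_mul_of_nonneg_left hKx hE0
    _ = _ := by ring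

end Literature.MathematicalPhysics.QuantumFieldTheory.Balaban1983to89.B9CubeCoarseningGlobal
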